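import Summits.CriticalPhenomena.PercolationContinuityZ3.Theorems.PercNearOneGluingNoHeavyConstsSplitLattice
import HarnessLib

/-!
# A lattice inequality for three-point connectivity laws: `μ(u alone)·μ(v alone or w alone) ≤ μ(u|v|w)·μ(uvw)`

builds on p205010 (kernel theorem, internal audit signed; external expert review pending)

Lane `prim/consts`, seat prim-consts-1 gen 13 (memo `FROM-prim-consts-1-g13-SKELETON.md` §8), helper file for the crux `NoHeavyLowerTail`
(stmt-CriticalPhenomena-4575; `--supports`): theorems only, no definitions, no sorries, standard axioms.

For three vertices `u, v, w` of a finite weighted graph write the law of the partition induced by the open clusters as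
`s = μ(u|v|w)`, `j_u = μ(u | vw)` (`u` alone: `u ↮ v`, `u ↮ w`, `v ⟷ w`), `j_v`, `j_w`, `k = μ(uvw)`.  THEOREM `Consts.real_alone_mul_alone_union_le`:
`j_u · (j_v + j_w) ≤ s · k` — the Ahlswede–Daykin (four functions) inequality `Consts.real_mul_real_le_of_lattice` applied to `A = {u alone}`,
`B = {v alone} ∪ {w alone}`: `ω ∩ ω'` separates all three points and `ω ∪ ω'` joins them.  In particular `j_u j_v ≤ s k` for every pair
(`Consts.real_alone_mul_alone_le`).  These are VALID INEQUALITIES FOR REALIZABLE THREE-POINT LAWS beyond Harris / TS / DUU, tight exactly on the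
"path families" (`j_v = 0 ⇒ s k = j_u j_w`), i.e. on the faces where the composition of `…ConstsTwoSumPoly` needs extra input (memo §3(a), §8:
with them the DUU of a terminal 2-sum at its private root `b` no longer fails numerically; the summed form `j_u j_v + j_u j_w + j_v j_w ≤ s k` holds in
every computed instance and is recorded as a question).  The four-point analogue is `Consts.real_split_mul_split_le`.
References: R. Ahlswede, D. E. Daykin, Z. Wahrsch. Verw. Gebiete 43 (1978) 183–185, Thm. 1; G. Grimmett, *Percolation* (1999), §2.2.
-/

namespace Summit.CriticalPhenomena.PercolationContinuityZ3.Theorems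

open MeasureTheory Set Literature.Probability.LatticeModels Literature.Probability.Percolation
open scoped Classical

namespace Consts

variable {V : Type*} [Fintype V]

/-- **`μ(u alone)·μ(v alone ∪ w alone) ≤ μ(u|v|w)·μ(uvw)`** for three vertices of a finite weighted graph (`x` alone = `x` separated from the
two others, which are joined): Ahlswede–Daykin with `ω ∩ ω'` (all three separated) and `ω ∪ ω'` (all three joined).
[cite: AhlswedeDaykin1978, Theorem 1] -/
theorem real_alone_mul_alone_union_le (w : Sym2 V → unitInterval) (u v x : V) :
    (prodBernoulli w).real ((openConn u v)ᶜ ∩ (openConn u x)ᶜ ∩ openConn v x) *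
        (prodBernoulli w).real (((openConn v u)ᶜ ∩ (openConn v x)ᶜ ∩ openConn u x) ∪ ((openConn x u)ᶜ ∩ (openConn x v)ᶜ ∩ openConn u v)) ≤
      (prodBernoulli w).real ((openConn u v)ᶜ ∩ (openConn u x)ᶜ ∩ (openConn v x)ᶜ) *
        (prodBernoulli w).real (openConn u v ∩ openConn u x ∩ openConn v x) := by
  refine real_mul_real_le_of_lattice w fun ω hω ω' hω' => ?_
  simp only [Set.mem_inter_iff, Set.mem_compl_iff, Set.mem_union] at hω hω' ⊢
  obtain ⟨⟨huv, hux⟩, hvx⟩ := hω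
  have r : ∀ {η : BondConfig V} {p q : V}, η ∈ openConn p q → (openGraph η).Reachable p q := fun h => h
  have m : ∀ {η : BondConfig V} {p q : V}, (openGraph η).Reachable p q → η ∈ openConn p q := fun h => h
  have dn : ∀ {p q : V}, (ω ∉ openConn p q ∨ ω' ∉ openConn p q) → ω ∩ ω' ∉ openConn p q := by
    intro p q hpq hmem
    rcases hpq with h | h
    · exact h (openConn_mono Set.inter_subset_left hmem)
    · exact h (openConn_mono Set.inter_subset_right hmem)
  have upl : ∀ {p q : V}, ω ∈ openConn p q → ω ∪ ω' ∈ openConn p q := fun h => openConn_mono Set.subset_union_left h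
  have upr : ∀ {p q : V}, ω' ∈ openConn p q → ω ∪ ω' ∈ openConn p q := fun h => openConn_mono Set.subset_union_right h
  rcases hω' with ⟨⟨hvu', hvx'⟩, hux'⟩ | ⟨⟨hxu', hxv'⟩, huv'⟩
  · -- `v` alone in `ω'`: `u ⟷ x` there
    refine ⟨⟨⟨dn (Or.inl huv), dn (Or.inl hux)⟩, dn (Or.inr hvx')⟩, ?_⟩
    have h1 := upr hux'
    have h2 := upl hvx
    exact ⟨⟨m ((r h1).trans (r h2).symm), h1⟩, h2⟩
  · -- `x` alone in `ω'`: `u ⟷ v` there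
    refine ⟨⟨⟨dn (Or.inl huv), dn (Or.inl hux)⟩, dn (Or.inr fun h => hxv' (m (r h).symm))⟩, ?_⟩
    have h1 := upr huv'
    have h2 := upl hvx
    exact ⟨⟨h1, m ((r h1).trans (r h2))⟩, h2⟩

/-- **`μ(u alone)·μ(v alone) ≤ μ(u|v|w)·μ(uvw)`** — the pairwise case of `Consts.real_alone_mul_alone_union_le`. [cite: AhlswedeDaykin1978, Theorem 1] -/
theorem real_alone_mul_alone_le (w : Sym2 V → unitInterval) (u v x : V) :
    (prodBernoulli w).real ((openConn u v)ᶜ ∩ (openConn u x)ᶜ ∩ openConn v x) *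
        (prodBernoulli w).real ((openConn v u)ᶜ ∩ (openConn v x)ᶜ ∩ openConn u x) ≤
      (prodBernoulli w).real ((openConn u v)ᶜ ∩ (openConn u x)ᶜ ∩ (openConn v x)ᶜ) *
        (prodBernoulli w).real (openConn u v ∩ openConn u x ∩ openConn v x) := by
  refine le_trans (mul_le_mul_of_nonneg_left (measureReal_mono Set.subset_union_left (measure_ne_top _ _)) measureReal_nonneg)
    (real_alone_mul_alone_union_le w u v x)

end Consts

end Summit.CriticalPhenomena.PercolationContinuityZ3.Theorems
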